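import Summits.BirchSwinnertonDyer.BirchSwinnertonDyer.Theorems.SignedLowerHalvesSmallImageLowerHalfBothSignsRttCharRoadE1OfCountPi
import Summits.BirchSwinnertonDyer.BirchSwinnertonDyer.Theorems.SignedLowerHalvesSmallImageLowerHalfBothSignsRttCharRoadE1CurveCountNonPrimitive
import Summits.BirchSwinnertonDyer.BirchSwinnertonDyer.Theorems.ResidualThetaTransportAtTwoResidualSignedLambdaLowerCMAtTwoCofreeTorsionCount
import Literature.NumberTheory.IwasawaTheory.Greenberg2006.LocalEulerPoincareCorankBase
import Mathlib.RingTheory.DedekindDomain.IntegralClosure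
import Mathlib.NumberTheory.Padics.RingHoms
import HarnessLib

/-!
# Route `SignedLowerHalves`, crux L `SmallImageLowerHalfBothSigns` (stmt-BirchSwinnertonDyer-23599), line `rtt_w3` v10′ — COUNT_π ⟸ INJ:
# the residual count at a uniformiser (COUNT_π, hypothesis `hcountPi` of `charRoad_count_of_countPi`, p763685) REDUCED to
# INJ «for every irreducible `π` of `𝒪 = 𝒪_{ℚ_p(S)}` there are `N` with `p^N ≤ #(𝒪/π)` and an INJECTION
# `Sel^{ε,S₀K}_𝒪(K_∞, (F/𝒪)(θ))[π] ↪ (S^{Σ₀,ε}(ℚ_∞, W[p^∞])[p])^N` into B. D. Kim's non-primitive signed Selmer group»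
# plus the two typed facts of [BDKim2009] (Prop. 2.11; Cor. 2.5 ∘ Prop. 2.6) — by the landed W-side count (p764851) and the residue arithmetic
# `#(𝒪/π)^e = #(𝒪/p) = p^{[F:ℚ_p]}` proved here.

LEAD `cruxlead-stmt-BirchSwinnertonDyer-23599` g6; helper `--supports stmt-BirchSwinnertonDyer-23599`; THEOREMS ONLY, no `sorry`; closes nothing;
CONDITIONAL on the named facts `h211`, `h2526` (VARIANT-N of the line card); BSD / crux L / COUNT / COUNT_π / INJ are NOT proved by this file.

WHY. The cohomological chain of route D (`Lines/rtt_w3-BRIEF-E1b-g6.md` §9.6, memo `Lines/rtt_w3-MEMO-D3c-w3g17.md` §3: torsion lift D5 → eigenline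
entry D3-b → local transport D3-θ/D3-W → quadratic descent D1/D2 → Kim's layer group → `K_∞`) produces exactly an injection of `Sel_θ[π]` into
`N = [k_S : 𝔽_p]` copies of `S^{Σ₀,ε}(ℚ_∞, W[p^∞])[p]`; everything after that (`#S^{Σ₀,ε}[p] = p^{λ+Σδ}`, `N·e ≤ [F:ℚ_p]`, exponent bookkeeping) is
discharged here once, so INJ is the byte-exact target of the remaining E1-b hands.

WHAT. §1 residue arithmetic of `𝒪 = padicCoeffIntegers S` (`ℚ_p(S)/ℚ_p` finite): `natCard_padicInt_quotient_span_prime` (`#(ℤ_p/p) = p`),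
`finrank_padicInt_unitBall_eq` (`rk_{ℤ_p} 𝒪 = [F:ℚ_p]`, Mathlib `IsIntegralClosure.rank`), `natCard_quotient_span_natCast_prime_eq_pow` (`#(𝒪/p) = p^{[F:ℚ_p]}`),
`natCard_quotient_span_pow_eq_of_irreducible` (`#(𝒪/π)^e = p^{[F:ℚ_p]}` for `p = u·πᵉ`), `mul_le_finrank_of_pow_le_natCard_quotient` (`p^N ≤ #(𝒪/π) ⇒ N·e ≤ [F:ℚ_p]`).
§2 ★ `charRoad_countPi_of_inj (h211) (h2526) (hinj : INJ) : COUNT_π` (COUNT_π VERBATIM = `hcountPi` of `charRoad_count_of_countPi`).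

References: [SerreLocalFields1979] II §3, I §4 Prop. 10 (`ef = n`); [NeukirchANT1999] Ch. II (4.8), (6.8); [BDKim2009] Prop. 2.11, Cor. 2.5, Prop. 2.6;
[EmertonPollackWeston2006] §3.1.
-/

set_option autoImplicit false
-- D-0017: single-problem summit, the namespace repeats the problem name by design.
set_option linter.dupNamespace false
noncomputable section

open scoped Classical MatrixGroups ModularForm BigOperators NumberField

open CongruenceSubgroup WeierstrassCurve Field Polynomial NumberField IsDedekindDomain Matrix
  Literature.NumberTheory.EllipticCurves Literature.NumberTheory.EllipticCurves.ModularForms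
  Literature.NumberTheory.EllipticCurves.Rank1Residual
  Literature.NumberTheory.EllipticCurves.Kobayashi2003
  Literature.NumberTheory.EllipticCurves.GreenbergVatsal2000 ZpExtension
  Literature.NumberTheory.IwasawaTheory Rat.HeightOneSpectrum
  Literature.NumberTheory.GaloisRepresentations Literature.NumberTheory.LFunctions
  Literature.NumberTheory.GaloisRepresentations.HeckeCharacter Literature.NumberTheory.Automorphic
  Summit.BirchSwinnertonDyer.Rank1Residual Summit.BirchSwinnertonDyer.Rank1Residual.Supersingular
  Summit.BirchSwinnertonDyer.Rank1Residual.X1.MuLambda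
  Summit.BirchSwinnertonDyer.Rank1Residual.X2.EulerFactorInvariants
  Summit.BirchSwinnertonDyer.BirchSwinnertonDyer.Theorems.SmallImageLambdaLowerThreeNsThetaTransport
  Summit.BirchSwinnertonDyer.BirchSwinnertonDyer.Theorems.HeckeThetaPartner
  Summit.BirchSwinnertonDyer.BirchSwinnertonDyer.Theorems

namespace Summit.BirchSwinnertonDyer.BirchSwinnertonDyer.Theorems.SmallImageRttCharRoad

/-! ## §1 Residue arithmetic of `𝒪 = 𝒪_{ℚ_p(S)}`: `#(𝒪/π)^e = #(𝒪/p) = p^{[F:ℚ_p]}` -/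

section ResidueArith

variable {p : ℕ} [Fact p.Prime]

/-- `#(ℤ_p ⧸ (p)) = p` (`ℤ_p/p ≅ ℤ/p` by `PadicInt.toZMod`). [cite: SerreLocalFields1979, II §3] -/
theorem natCard_padicInt_quotient_span_prime : Nat.card (ℤ_[p] ⧸ Ideal.span {((p : ℕ) : ℤ_[p])}) = p := by
  have hker : Ideal.span {((p : ℕ) : ℤ_[p])} = RingHom.ker (PadicInt.toZMod (p := p)) := by
    rw [PadicInt.ker_toZMod, PadicInt.maximalIdeal_eq_span_p]
  rw [Nat.card_congr ((Ideal.quotEquivOfEq hker).trans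
      (RingHom.quotientKerEquivOfSurjective (ZMod.ringHom_surjective (PadicInt.toZMod (p := p))))).toEquiv,
    Nat.card_zmod]

variable (E : IntermediateField ℚ_[p] (PadicAlgCl p)) [FiniteDimensional ℚ_[p] E]

/-- `rk_{ℤ_p} 𝒪_E = [E : ℚ_p]` for the unit ball `𝒪_E` of a finite `E/ℚ_p` (the integral closure of the PID `ℤ_p`; Mathlib `IsIntegralClosure.rank`).
[cite: NeukirchANT1999, Ch. II (6.8)] [cite: SerreLocalFields1979, I §4 Prop. 10] -/
theorem finrank_padicInt_unitBall_eq :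
    Module.finrank ℤ_[p] (PadicIntermediateField.unitBall p E) = Module.finrank ℚ_[p] E :=
  IsIntegralClosure.rank ℤ_[p] ℚ_[p] E (PadicIntermediateField.unitBall p E)

variable (S : Set (PadicAlgCl p)) [FiniteDimensional ℚ_[p] (padicCoeffField S)]

/-- **`#(𝒪/p𝒪) = p^{[F:ℚ_p]}`** for `𝒪 = padicCoeffIntegers S`, `F = ℚ_p(S)` finite over `ℚ_p` (`𝒪 ≅ ℤ_p^{[F:ℚ_p]}` as a `ℤ_p`-module).
[cite: SerreLocalFields1979, I §4 Prop. 10, II §3] [cite: NeukirchANT1999, Ch. II (4.8), (6.8)] -/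
theorem natCard_quotient_span_natCast_prime_eq_pow :
    Nat.card (padicCoeffIntegers S ⧸ Ideal.span {((p : ℕ) : padicCoeffIntegers S)}) = p ^ Module.finrank ℚ_[p] (padicCoeffField S) := by
  rw [padicCoeffIntegers_eq_unitBall S]
  let b := Module.finBasis ℤ_[p] (PadicIntermediateField.unitBall p (padicCoeffField S))
  have B : (Fin (Module.finrank ℤ_[p] (PadicIntermediateField.unitBall p (padicCoeffField S))) → ℤ_[p]) ≃+
      PadicIntermediateField.unitBall p (padicCoeffField S) :=
    b.equivFun.symm.toAddEquiv
  rw [ThetaTransport.CofreeTorsionCount.natCard_quotient_span_natCast_of_addEquiv p B, natCard_padicInt_quotient_span_prime,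
    finrank_padicInt_unitBall_eq]

/-- **`#(𝒪/π)^e = p^{[F:ℚ_p]}` when `p = u·πᵉ`** (`u` a unit, `π` irreducible): `#(𝒪/πᵉ) = #(𝒪/π)^e` (`Greenberg2006.natCard_quotient_span_pow`) and
`(πᵉ) = (p)`. [cite: SerreLocalFields1979, I §4 Prop. 10, II §3] -/
theorem natCard_quotient_span_pow_eq_of_irreducible {π u : padicCoeffIntegers S} {e : ℕ} (hπ : Irreducible π) (hu : IsUnit u)
    (hpe : ((p : ℕ) : padicCoeffIntegers S) = u * π ^ e) :
    Nat.card (padicCoeffIntegers S ⧸ Ideal.span {π}) ^ e = p ^ Module.finrank ℚ_[p] (padicCoeffField S) := by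
  rw [← Literature.NumberTheory.IwasawaTheory.Greenberg2006.natCard_quotient_span_pow hπ.ne_zero e]
  have hspan : Ideal.span {π ^ e} = Ideal.span {((p : ℕ) : padicCoeffIntegers S)} := by
    rw [hpe, Ideal.span_singleton_mul_left_unit hu]
  rw [hspan]
  exact natCard_quotient_span_natCast_prime_eq_pow S

/-- **`p^N ≤ #(𝒪/π)` and `p = u·πᵉ` force `N·e ≤ [F:ℚ_p]`** (`(#(𝒪/π))ᵉ = p^{[F:ℚ_p]}`). [cite: SerreLocalFields1979, I §4 Prop. 10] -/
theorem mul_le_finrank_of_pow_le_natCard_quotient {π u : padicCoeffIntegers S} {e N : ℕ} (hπ : Irreducible π) (hu : IsUnit u)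
    (hpe : ((p : ℕ) : padicCoeffIntegers S) = u * π ^ e) (hN : p ^ N ≤ Nat.card (padicCoeffIntegers S ⧸ Ideal.span {π})) :
    N * e ≤ Module.finrank ℚ_[p] (padicCoeffField S) := by
  have h := Nat.pow_le_pow_left hN e
  rw [← pow_mul, natCard_quotient_span_pow_eq_of_irreducible S hπ hu hpe] at h
  exact (Nat.pow_le_pow_iff_right (Fact.out : p.Prime).one_lt).mp h

end ResidueArith

/-! ## §2 COUNT_π ⟸ INJ ∧ [BDKim2009, Prop. 2.11, Cor. 2.5 ∘ Prop. 2.6] -/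

/-- ★ **COUNT_π ⟸ INJ.** Hypotheses: the typed facts `h211` ([BDKim2009] Prop. 2.11: no finite submodule in `S^{Σ₀,±}(E/ℚ_∞)^∨`) and `h2526` (Cor. 2.5 ∘
Prop. 2.6: `λ(S^{Σ₀,±}{}^∨) = λ(X^±) + Σ_{Σ₀} δ`, `μ = 0`), and `hinj` = INJ (module docstring: for every irreducible `π`, an `N` with `p^N ≤ #(𝒪/π)` and an
injection `Sel_θ[π] ↪ (S^{Σ₀,ε}(ℚ_∞, W[p^∞])[p])^N`); conclusion = COUNT_π VERBATIM (= `hcountPi` of `charRoad_count_of_countPi`, p763685). Proof: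
`#Sel_θ[π] ≤ (#S^{Σ₀,ε}[p])^N = p^{N(λ+Σδ)}` (p764851) and `N·e ≤ [F:ℚ_p]` (`mul_le_finrank_of_pow_le_natCard_quotient`). CONDITIONAL reduction; closes nothing;
BSD / crux L / COUNT_π not proved. [cite: BDKim2009, Prop. 2.11, Cor. 2.5, Prop. 2.6] [cite: SerreLocalFields1979, I §4 Prop. 10] -/
theorem charRoad_countPi_of_inj (h211 : BDKim2009.prop211_nonPrimitiveSignedDual_noFiniteSubmodule)
    (h2526 : BDKim2009.cor25_prop26_lambda_nonPrimitive_eq_add_sum_delta)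
    (hinj : ∀ (W : WeierstrassCurve ℚ) [W.IsElliptic] [W.IsGloballyMinimal] (p : ℕ) [Fact p.Prime],
            ∀ (hp : p ≠ 2), ClassX7 W p → ¬ W.HasCM → W.frobeniusTrace p = 0 → ¬ Surj W p →
            ¬ (∃ (A : WeierstrassCurve ℚ) (_ : A.IsElliptic) (_ : A.IsGloballyMinimal),
              A.HasCM ∧ GoodSS A p ∧ A.frobeniusTrace p = 0 ∧
                ∃ e : geomTorsion W (p : ℤ) ≃+ geomTorsion A (p : ℤ),
                  ∀ (σ : absoluteGaloisGroup ℚ) (P : geomTorsion W (p : ℤ)), e (σ • P) = σ • e P) →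
            ¬ (∃ (A : WeierstrassCurve ℚ) (_ : A.IsElliptic) (_ : A.IsGloballyMinimal) (t : ℚ),
              A.HasGoodReductionAtPrime p ∧ A.frobeniusTrace p = 0 ∧
                (∃ e : geomTorsion W (p : ℤ) ≃+ geomTorsion A (p : ℤ),
                  ∀ (σ : absoluteGaloisGroup ℚ) (P : geomTorsion W (p : ℤ)), e (σ • P) = σ • e P) ∧
                A.entireLFunction 1 / (A.realPeriodRat : ℂ) = ((t : ℚ) : ℂ) ∧ t ≠ 0 ∧ padicValRat p t = 0) →
            ∀ (ε : ℤˣ) (K : Type) [Field K] [NumberField K] (σK : K →+* ℂ) (𝔪 : Ideal (𝓞 K))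
              (ψ : HeightOneSpectrum (𝓞 K) → ℂ) (e : PadicAlgCl p ≃+* ℂ),
              ∀ (hK2 : Module.finrank ℚ K = 2), IsTotallyComplex K → 𝔪 ≠ ⊥ →
              (∀ I : Ideal (𝓞 K), Ideal.absNorm I ≠ p) → ¬ p ∣ (NumberField.discr K).natAbs * Ideal.absNorm 𝔪 →
              (∀ (ℓ : ℕ) [Fact ℓ.Prime], ℓ ∣ (NumberField.discr K).natAbs * Ideal.absNorm 𝔪 → ¬ W.HasGoodReductionAtPrime ℓ) →
              IsGrossencharakter 𝔪 (embType σK) (embTypeConj σK) ψ →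
              (∀ n : ℕ, Odd n → n.Coprime ((NumberField.discr K).natAbs * Ideal.absNorm 𝔪) →
                idealPow K ψ (Ideal.span {(n : 𝓞 K)}) = (jacobiSym (NumberField.discr K) n : ℂ) * (n : ℂ) ^ (2 - 1)) →
              (∀ (ℓ : ℕ) [Fact ℓ.Prime], ℓ ≠ p → W.HasGoodReductionAtPrime ℓ →
                ‖e.symm (∑ᶠ (w : HeightOneSpectrum (𝓞 K)) (_ : Ideal.absNorm w.asIdeal = ℓ), ψ w) -
                  (W.frobeniusTrace ℓ : PadicAlgCl p)‖ < 1) →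
              (∃ v : HeightOneSpectrum (𝓞 K), v.asIdeal = Ideal.span {(p : 𝓞 K)} ∧ Nat.card (𝓞 K ⧸ v.asIdeal) = p ^ 2) →
              ¬ (p : ℤ) ∣ NumberField.discr K →
            ∀ (Φ : Multiplicative (AddAut (geomTorsion W p)) ≃* GL (Fin 2) (ZMod p))
              (k : Subalgebra (ZMod p) (Matrix (Fin 2) (Fin 2) (ZMod p))) (e₀ : geomTorsion W p ≃+ (Fin 2 → ZMod p)),
              (∀ (g : Multiplicative (AddAut (geomTorsion W p))) (x : geomTorsion W p),
                e₀ (Multiplicative.toAdd g x) = ((Φ g : GL (Fin 2) (ZMod p)) : Matrix (Fin 2) (Fin 2) (ZMod p)) *ᵥ e₀ x) →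
              IsField k → Module.finrank (ZMod p) k = 2 →
              (letI : Module (ZMod p) (geomTorsion W p) := AddSubgroup.torsionBy.zmodModule
                ∀ g : Multiplicative (AddAut (geomTorsion W p)),
                  Matrix.trace ((Φ g : GL (Fin 2) (ZMod p)) : Matrix (Fin 2) (Fin 2) (ZMod p)) =
                    LinearMap.trace (ZMod p) (geomTorsion W p) ((Multiplicative.toAdd g).toAddMonoidHom.toZModLinearMap p)) →
              (galoisRepTorsion W p).range.map Φ.toMonoidHom ≤
                Subgroup.normalizer (Serre1972.unitGroup k : Set (GL (Fin 2) (ZMod p))) →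
              ((Serre1972.unitGroup k).comap Φ.toMonoidHom).comap (galoisRepTorsion W p) ≤
                (absGaloisRestrict ℚ K).toMonoidHom.range →
              (∀ τ : absoluteGaloisGroup K, Φ (galoisRepTorsion W p (absGaloisRestrict ℚ K τ)) ∈ Serre1972.unitGroup k) →
            ∀ (M : ℕ) [NeZero M] (g : CuspForm (Gamma0 M) 2) (ι : coeffField g →+* PadicAlgCl p) (Ω : ℂ),
              ¬ p ∣ M → IsNewform0 g → Literature.NumberTheory.Automorphic.IsCMForm (liftToGamma1 M 2 g) →
              cuspCoeff g p = 0 → IsCohomologicalPlusPeriod g ι Ω →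
              (∀ ℓ : ℕ, ℓ.Prime → ¬ ℓ ∣ p * M * W.conductorNorm ℤ →
                ‖embCoeff g ι ℓ - (W.frobeniusTrace ℓ : PadicAlgCl p)‖ < 1) →
              (∀ ℓ : ℕ, ℓ.Prime → ¬ ℓ ∣ (NumberField.discr K).natAbs * Ideal.absNorm 𝔪 →
                embCoeff g ι ℓ = e.symm (∑ᶠ (w : HeightOneSpectrum (𝓞 K)) (_ : Ideal.absNorm w.asIdeal = ℓ), ψ w)) →
              ∀ (κ : ZpExtension ℚ p) (γ : absoluteGaloisGroup ℚ),
                κ.IsCyclotomic → κ.IsTopGenerator γ → IsCyclotomicVariable p γ →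
              ∀ (S₀ : Finset (HeightOneSpectrum (𝓞 ℚ))), (∀ v ∈ S₀, ((p : ℕ) : 𝓞 ℚ) ∉ v.asIdeal) →
                (∀ v : HeightOneSpectrum (𝓞 ℚ), ¬ W.HasGoodReductionAt v → v ∈ S₀) →
                (∀ v : HeightOneSpectrum (𝓞 ℚ), natGenerator v ∣ M → v ∈ S₀) →
              ∀ (S : Set (PadicAlgCl p)) (θ : FramedGaloisRep K (padicCoeffIntegers S) 1) (γK : absoluteGaloisGroup K)
                (j : (W.baseChange K).geomPrimaryTorsion p →+ (GreenbergSelmer.Cofree θ (padicCoeffField S))),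
                0 < Module.finrank ℚ_[p] (padicCoeffField S) →
                (∀ w : HeightOneSpectrum (𝓞 K), (p : 𝓞 K) ∉ w.asIdeal → ¬ 𝔪 ≤ w.asIdeal →
                  θ.IsUnramifiedAt w ∧ ∃ P : Polynomial (padicCoeffIntegers S),
                    P.map (padicCoeffIntegers S).subtype = X - C (e.symm (ψ w)) ∧ θ.HasFrobCharpolyAt w P) →
                (κ.restrictOfFinrankEqTwo hp K hK2).IsTopGenerator γK →
                (∀ v : HeightOneSpectrum (𝓞 K), (p : 𝓞 K) ∈ v.asIdeal →
                  ∀ (δ : absoluteGaloisGroup (v.adicCompletion K)) (t : (W.baseChange K).geomPrimaryTorsion p),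
                    j (resGalOfEmb (closureEmb (K := K) (v.adicCompletion K)) δ • t) =
                      resGalOfEmb (closureEmb (K := K) (v.adicCompletion K)) δ • j t) →
                Submodule.span (padicCoeffIntegers S) (Set.range j) = ⊤ →
              ∀ (π : padicCoeffIntegers S), Irreducible π →
                ∃ N : ℕ, p ^ N ≤ Nat.card (padicCoeffIntegers S ⧸ Ideal.span {π}) ∧
                  ∃ incl : {s : SmallImageCharSignedSelmer.signedTransportSelmerInftySat (κ.restrictOfFinrankEqTwo hp K hK2)
                    (GreenbergSelmer.Cofree θ (padicCoeffField S)) (padicCoeffIntegers S) (W.baseChange K) j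
                    {w : HeightOneSpectrum (𝓞 K) | ∃ v ∈ S₀, ((natGenerator v : ℕ) : 𝓞 K) ∈ w.asIdeal} ε | GreenbergSelmer.scalarH1 (κ.restrictOfFinrankEqTwo hp K hK2).kerSubgroup (GreenbergSelmer.Cofree θ (padicCoeffField S)) π s = 0} →
                      (Fin N → {x : BDKim2009.nonPrimitiveSignedSelmerInfty W κ (S₀ : Set (HeightOneSpectrum (𝓞 ℚ))) ε | p • x = 0}),
                    Function.Injective incl) :
    ∀ (W : WeierstrassCurve ℚ) [W.IsElliptic] [W.IsGloballyMinimal] (p : ℕ) [Fact p.Prime],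
          ∀ (hp : p ≠ 2), ClassX7 W p → ¬ W.HasCM → W.frobeniusTrace p = 0 → ¬ Surj W p →
          ¬ (∃ (A : WeierstrassCurve ℚ) (_ : A.IsElliptic) (_ : A.IsGloballyMinimal),
            A.HasCM ∧ GoodSS A p ∧ A.frobeniusTrace p = 0 ∧
              ∃ e : geomTorsion W (p : ℤ) ≃+ geomTorsion A (p : ℤ),
                ∀ (σ : absoluteGaloisGroup ℚ) (P : geomTorsion W (p : ℤ)), e (σ • P) = σ • e P) →
          ¬ (∃ (A : WeierstrassCurve ℚ) (_ : A.IsElliptic) (_ : A.IsGloballyMinimal) (t : ℚ),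
            A.HasGoodReductionAtPrime p ∧ A.frobeniusTrace p = 0 ∧
              (∃ e : geomTorsion W (p : ℤ) ≃+ geomTorsion A (p : ℤ),
                ∀ (σ : absoluteGaloisGroup ℚ) (P : geomTorsion W (p : ℤ)), e (σ • P) = σ • e P) ∧
              A.entireLFunction 1 / (A.realPeriodRat : ℂ) = ((t : ℚ) : ℂ) ∧ t ≠ 0 ∧ padicValRat p t = 0) →
          ∀ (ε : ℤˣ) (K : Type) [Field K] [NumberField K] (σK : K →+* ℂ) (𝔪 : Ideal (𝓞 K))
            (ψ : HeightOneSpectrum (𝓞 K) → ℂ) (e : PadicAlgCl p ≃+* ℂ),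
            ∀ (hK2 : Module.finrank ℚ K = 2), IsTotallyComplex K → 𝔪 ≠ ⊥ →
            (∀ I : Ideal (𝓞 K), Ideal.absNorm I ≠ p) → ¬ p ∣ (NumberField.discr K).natAbs * Ideal.absNorm 𝔪 →
            (∀ (ℓ : ℕ) [Fact ℓ.Prime], ℓ ∣ (NumberField.discr K).natAbs * Ideal.absNorm 𝔪 → ¬ W.HasGoodReductionAtPrime ℓ) →
            IsGrossencharakter 𝔪 (embType σK) (embTypeConj σK) ψ →
            (∀ n : ℕ, Odd n → n.Coprime ((NumberField.discr K).natAbs * Ideal.absNorm 𝔪) →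
              idealPow K ψ (Ideal.span {(n : 𝓞 K)}) = (jacobiSym (NumberField.discr K) n : ℂ) * (n : ℂ) ^ (2 - 1)) →
            (∀ (ℓ : ℕ) [Fact ℓ.Prime], ℓ ≠ p → W.HasGoodReductionAtPrime ℓ →
              ‖e.symm (∑ᶠ (w : HeightOneSpectrum (𝓞 K)) (_ : Ideal.absNorm w.asIdeal = ℓ), ψ w) -
                (W.frobeniusTrace ℓ : PadicAlgCl p)‖ < 1) →
            (∃ v : HeightOneSpectrum (𝓞 K), v.asIdeal = Ideal.span {(p : 𝓞 K)} ∧ Nat.card (𝓞 K ⧸ v.asIdeal) = p ^ 2) →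
            ¬ (p : ℤ) ∣ NumberField.discr K →
          ∀ (Φ : Multiplicative (AddAut (geomTorsion W p)) ≃* GL (Fin 2) (ZMod p))
            (k : Subalgebra (ZMod p) (Matrix (Fin 2) (Fin 2) (ZMod p))) (e₀ : geomTorsion W p ≃+ (Fin 2 → ZMod p)),
            (∀ (g : Multiplicative (AddAut (geomTorsion W p))) (x : geomTorsion W p),
              e₀ (Multiplicative.toAdd g x) = ((Φ g : GL (Fin 2) (ZMod p)) : Matrix (Fin 2) (Fin 2) (ZMod p)) *ᵥ e₀ x) →
            IsField k → Module.finrank (ZMod p) k = 2 →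
            (letI : Module (ZMod p) (geomTorsion W p) := AddSubgroup.torsionBy.zmodModule
              ∀ g : Multiplicative (AddAut (geomTorsion W p)),
                Matrix.trace ((Φ g : GL (Fin 2) (ZMod p)) : Matrix (Fin 2) (Fin 2) (ZMod p)) =
                  LinearMap.trace (ZMod p) (geomTorsion W p) ((Multiplicative.toAdd g).toAddMonoidHom.toZModLinearMap p)) →
            (galoisRepTorsion W p).range.map Φ.toMonoidHom ≤
              Subgroup.normalizer (Serre1972.unitGroup k : Set (GL (Fin 2) (ZMod p))) →
            ((Serre1972.unitGroup k).comap Φ.toMonoidHom).comap (galoisRepTorsion W p) ≤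
              (absGaloisRestrict ℚ K).toMonoidHom.range →
            (∀ τ : absoluteGaloisGroup K, Φ (galoisRepTorsion W p (absGaloisRestrict ℚ K τ)) ∈ Serre1972.unitGroup k) →
          ∀ (M : ℕ) [NeZero M] (g : CuspForm (Gamma0 M) 2) (ι : coeffField g →+* PadicAlgCl p) (Ω : ℂ),
            ¬ p ∣ M → IsNewform0 g → Literature.NumberTheory.Automorphic.IsCMForm (liftToGamma1 M 2 g) →
            cuspCoeff g p = 0 → IsCohomologicalPlusPeriod g ι Ω →
            (∀ ℓ : ℕ, ℓ.Prime → ¬ ℓ ∣ p * M * W.conductorNorm ℤ →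
              ‖embCoeff g ι ℓ - (W.frobeniusTrace ℓ : PadicAlgCl p)‖ < 1) →
            (∀ ℓ : ℕ, ℓ.Prime → ¬ ℓ ∣ (NumberField.discr K).natAbs * Ideal.absNorm 𝔪 →
              embCoeff g ι ℓ = e.symm (∑ᶠ (w : HeightOneSpectrum (𝓞 K)) (_ : Ideal.absNorm w.asIdeal = ℓ), ψ w)) →
            ∀ (κ : ZpExtension ℚ p) (γ : absoluteGaloisGroup ℚ),
              κ.IsCyclotomic → κ.IsTopGenerator γ → IsCyclotomicVariable p γ →
            ∀ (S₀ : Finset (HeightOneSpectrum (𝓞 ℚ))), (∀ v ∈ S₀, ((p : ℕ) : 𝓞 ℚ) ∉ v.asIdeal) →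
              (∀ v : HeightOneSpectrum (𝓞 ℚ), ¬ W.HasGoodReductionAt v → v ∈ S₀) →
              (∀ v : HeightOneSpectrum (𝓞 ℚ), natGenerator v ∣ M → v ∈ S₀) →
            ∀ (S : Set (PadicAlgCl p)) (θ : FramedGaloisRep K (padicCoeffIntegers S) 1) (γK : absoluteGaloisGroup K)
              (j : (W.baseChange K).geomPrimaryTorsion p →+ (GreenbergSelmer.Cofree θ (padicCoeffField S))),
              0 < Module.finrank ℚ_[p] (padicCoeffField S) →
              (∀ w : HeightOneSpectrum (𝓞 K), (p : 𝓞 K) ∉ w.asIdeal → ¬ 𝔪 ≤ w.asIdeal →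
                θ.IsUnramifiedAt w ∧ ∃ P : Polynomial (padicCoeffIntegers S),
                  P.map (padicCoeffIntegers S).subtype = X - C (e.symm (ψ w)) ∧ θ.HasFrobCharpolyAt w P) →
              (κ.restrictOfFinrankEqTwo hp K hK2).IsTopGenerator γK →
              (∀ v : HeightOneSpectrum (𝓞 K), (p : 𝓞 K) ∈ v.asIdeal →
                ∀ (δ : absoluteGaloisGroup (v.adicCompletion K)) (t : (W.baseChange K).geomPrimaryTorsion p),
                  j (resGalOfEmb (closureEmb (K := K) (v.adicCompletion K)) δ • t) =
                    resGalOfEmb (closureEmb (K := K) (v.adicCompletion K)) δ • j t) →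
              Submodule.span (padicCoeffIntegers S) (Set.range j) = ⊤ →
            ∀ (π u : padicCoeffIntegers S) (eram : ℕ), Irreducible π → IsUnit u →
              ((p : ℕ) : padicCoeffIntegers S) = u * π ^ eram →
            ∀ (D : SignedSelmerDualData W κ γ ε) [Module.Finite (IwasawaAlgebra p) D.X],
              Module.IsTorsion (IwasawaAlgebra p) D.X → D.mu = 0 →
              {s : SmallImageCharSignedSelmer.signedTransportSelmerInftySat (κ.restrictOfFinrankEqTwo hp K hK2)
                  (GreenbergSelmer.Cofree θ (padicCoeffField S)) (padicCoeffIntegers S) (W.baseChange K) j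
                  {w : HeightOneSpectrum (𝓞 K) | ∃ v ∈ S₀, ((natGenerator v : ℕ) : 𝓞 K) ∈ w.asIdeal} ε | GreenbergSelmer.scalarH1 (κ.restrictOfFinrankEqTwo hp K hK2).kerSubgroup (GreenbergSelmer.Cofree θ (padicCoeffField S)) π s = 0}.Finite ∧
                Nat.card {s : SmallImageCharSignedSelmer.signedTransportSelmerInftySat (κ.restrictOfFinrankEqTwo hp K hK2)
                  (GreenbergSelmer.Cofree θ (padicCoeffField S)) (padicCoeffIntegers S) (W.baseChange K) j
                  {w : HeightOneSpectrum (𝓞 K) | ∃ v ∈ S₀, ((natGenerator v : ℕ) : 𝓞 K) ∈ w.asIdeal} ε | GreenbergSelmer.scalarH1 (κ.restrictOfFinrankEqTwo hp K hK2).kerSubgroup (GreenbergSelmer.Cofree θ (padicCoeffField S)) π s = 0} ^ eram ≤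
                  p ^ (Module.finrank ℚ_[p] (padicCoeffField S) * (lambdaInvariant p D.X + ∑ v ∈ S₀, delta W p v)) := by
  intro W _ _ p _ hp hX hcm hap hs hT1 hTu ε K _ _ σK 𝔪 ψ e hK2 htc h𝔪 hnop hpD hbad hψG hneb htrace hv hpd
      Φ k e₀ he₀ hk h2 htr hGN hUle hKU M _ g ι Ω hpM hnew hcmf hapg hΩ hcong hcoeff κ γ hκ hγ hγT S₀ hS₀p hS₀bad hS₀M
      S θ γK j hfin hθ hγK hjeq hjspan π u eram hπ hu hpe D _ htor hμ
  haveI : FiniteDimensional ℚ_[p] (padicCoeffField S) := Module.finite_of_finrank_pos hfin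
  obtain ⟨N, hN, incl, hincl⟩ :=
    hinj W p hp hX hcm hap hs hT1 hTu ε K σK 𝔪 ψ e hK2 htc h𝔪 hnop hpD hbad hψG hneb htrace hv hpd Φ k e₀ he₀ hk h2 htr hGN hUle hKU M g ι Ω hpM hnew hcmf hapg hΩ hcong hcoeff κ γ hκ hγ hγT S₀ hS₀p hS₀bad hS₀M S θ γK j hfin hθ hγK hjeq hjspan π hπ
  obtain ⟨hKfin, hKcard⟩ := NonPrimitiveSignedDualDataCount.finite_and_natCard_pTorsion_eq_pow h211 h2526 hp hX.1.1 hap hκ hγ S₀ hS₀p hS₀bad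
    D htor hμ (BDKim2009.nonPrimitiveSignedDualData W κ (S₀ : Set (HeightOneSpectrum (𝓞 ℚ))) ε hγ)
  haveI := hKfin.to_subtype
  haveI hSfin := Finite.of_injective incl hincl
  refine ⟨Set.toFinite _, ?_⟩
  have hle : Nat.card {s : SmallImageCharSignedSelmer.signedTransportSelmerInftySat (κ.restrictOfFinrankEqTwo hp K hK2)
                    (GreenbergSelmer.Cofree θ (padicCoeffField S)) (padicCoeffIntegers S) (W.baseChange K) j
                    {w : HeightOneSpectrum (𝓞 K) | ∃ v ∈ S₀, ((natGenerator v : ℕ) : 𝓞 K) ∈ w.asIdeal} ε | GreenbergSelmer.scalarH1 (κ.restrictOfFinrankEqTwo hp K hK2).kerSubgroup (GreenbergSelmer.Cofree θ (padicCoeffField S)) π s = 0} ≤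
      (p ^ (lambdaInvariant p D.X + ∑ v ∈ S₀, delta W p v)) ^ N := by
    rw [← hKcard, ← Nat.card_fin N, ← Nat.card_fun]
    exact Nat.card_le_card_of_injective incl hincl
  calc Nat.card {s : SmallImageCharSignedSelmer.signedTransportSelmerInftySat (κ.restrictOfFinrankEqTwo hp K hK2)
                      (GreenbergSelmer.Cofree θ (padicCoeffField S)) (padicCoeffIntegers S) (W.baseChange K) j
                      {w : HeightOneSpectrum (𝓞 K) | ∃ v ∈ S₀, ((natGenerator v : ℕ) : 𝓞 K) ∈ w.asIdeal} ε | GreenbergSelmer.scalarH1 (κ.restrictOfFinrankEqTwo hp K hK2).kerSubgroup (GreenbergSelmer.Cofree θ (padicCoeffField S)) π s = 0} ^ eram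
      ≤ ((p ^ (lambdaInvariant p D.X + ∑ v ∈ S₀, delta W p v)) ^ N) ^ eram := Nat.pow_le_pow_left hle eram
    _ = p ^ ((N * eram) * (lambdaInvariant p D.X + ∑ v ∈ S₀, delta W p v)) := by
        rw [← pow_mul, ← pow_mul]; ring_nf
    _ ≤ p ^ (Module.finrank ℚ_[p] (padicCoeffField S) * (lambdaInvariant p D.X + ∑ v ∈ S₀, delta W p v)) :=
        Nat.pow_le_pow_right (Fact.out : p.Prime).pos
          (Nat.mul_le_mul_right _ (mul_le_finrank_of_pow_le_natCard_quotient S hπ hu hpe hN))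

end Summit.BirchSwinnertonDyer.BirchSwinnertonDyer.Theorems.SmallImageRttCharRoad

end
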